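import Summits.PneNP.PneNP.Theorems.Capture.Negative.LoadBearing
import Literature.Computability.Complexity.CircuitLP

/-!
# Sketch — crux `Capture` (stmt-PneNP-2659), round 2, ideator 6 (planner-cruxidea-stmt-PneNP-2659-6-0)

Typed first lemmas of the two idea cards of this seat (statements are `def … : Prop` unless proved):

* Card **monotone-sandwich-completeness** (§1): `upClosure` / `downInterior` (the two monotone
  envelopes `C↑`, `C↓` of an arbitrary Boolean function), `IsSandwich`, `eq_of_isSandwich` (PROVED: for a
  monotone `f` the sandwich collapses to `f`), `MSCB` (promise-free strengthening of the crux: EVERY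
  `B₂`-circuit has a polynomial `B_s`-circuit computing SOME monotone function between its envelopes),
  `capture_of_MSCB : MSCB → Capture` (PROVED), `MSC` (the same with target basis `B₂`: a purely Boolean
  statement, no wide gates), `MSCB_of_MSC_and_Capture` (statement: under `MSC` the crux and `MSCB`
  coincide), `slicePad` + `CompleteInstance` (statement: description-slice padding makes one function
  complete — a sandwich of the padded evaluator restricts to a sandwich of every described function).
* Card **downface-rank-repair** (§2): `LPDownExact` (rank-0 criterion on the Valiant–Yannakakis
  transcript LP `CircuitLPFeasible` of an arbitrary De Morgan circuit for `f`: no REAL accepting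
  transcript below a `0`-point), `RankZeroRepair` (statement: then `f` is ONE CONV gate of size
  `O(|C| + n)`), `LiftOp` / `RankRepair` (statement of the general principle over an abstract
  lift-and-project operator commuting with faces of the cube).
-/

set_option linter.dupNamespace false

noncomputable section

namespace Summit.PneNP.PneNP.Cruxes.Capture.Ideator6

open Literature.Computability.Complexity
open Summit.PneNP.PneNP.Theses.ConvexRankGates (Capture)
open Summit.PneNP.PneNP.Theorems.Capture.Negative (CaptureInto capture_iff)

attribute [local instance] Classical.propDecidable

variable {ι : Type*}

/-! ## §1 Monotone envelopes, sandwiches, the promise-free strengthening and its complete instance -/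

/-- Upward closure `f↑ (x) = [∃ x' ≤ x, f x' = 1]` (Jukna 2021 §3 "upwards closure"; the least monotone
majorant). -/
def upClosure (f : (ι → Bool) → Bool) : (ι → Bool) → Bool :=
  fun x => decide (∃ x' : ι → Bool, x' ≤ x ∧ f x' = true)

/-- Downward interior `f↓ (x) = [∀ x' ≥ x, f x' = 1]` (the greatest monotone minorant; `f↓ = ((¬f)∘¬)↑`
dualised). -/
def downInterior (f : (ι → Bool) → Bool) : (ι → Bool) → Bool :=
  fun x => decide (∀ x' : ι → Bool, x ≤ x' → f x' = true)

/-- `g` is a MONOTONE SANDWICH of `f`: monotone and `f↓ ≤ g ≤ f↑` pointwise. For monotone `f` the only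
sandwich is `f` itself (`eq_of_isSandwich`); for general `f` the interval `[f↓, f↑]` is wide. -/
def IsSandwich (f g : (ι → Bool) → Bool) : Prop :=
  Monotone g ∧ (∀ x, downInterior f x ≤ g x) ∧ (∀ x, g x ≤ upClosure f x)

theorem upClosure_eq_false_of_monotone {f : (ι → Bool) → Bool} (hf : Monotone f) {x : ι → Bool}
    (hx : f x = false) : upClosure f x = false := by
  unfold upClosure
  rw [decide_eq_false_iff_not]
  rintro ⟨x', hx'x, hfx'⟩
  have h := Bool.le_iff_imp.1 (hf hx'x) hfx'
  rw [hx] at h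
  exact Bool.false_ne_true h

theorem downInterior_eq_true_of_monotone {f : (ι → Bool) → Bool} (hf : Monotone f) {x : ι → Bool}
    (hx : f x = true) : downInterior f x = true := by
  unfold downInterior
  rw [decide_eq_true_iff]
  intro x' hxx'
  exact Bool.le_iff_imp.1 (hf hxx') hx

/-- **The sandwich of a monotone function is the function.** (So the promise-free statement `MSCB`
below specialises to the crux on monotone `f`.) [folklore] -/
theorem eq_of_isSandwich {f g : (ι → Bool) → Bool} (hf : Monotone f) (h : IsSandwich f g) : g = f := by
  obtain ⟨-, hlo, hhi⟩ := h
  funext x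
  cases hx : f x with
  | false =>
    have hu := upClosure_eq_false_of_monotone hf hx
    have h1 := hhi x
    rw [hu] at h1
    cases hg : g x with
    | false => rfl
    | true => rw [hg] at h1; exact absurd h1 (by decide)
  | true =>
    have hd := downInterior_eq_true_of_monotone hf hx
    have h1 := hlo x
    rw [hd] at h1
    cases hg : g x with
    | false => rw [hg] at h1; exact absurd h1 (by decide)
    | true => rfl

/-- **MSC_B — the promise-free strengthening of `Capture`.** EVERY `B₂`-circuit `C` (no monotonicity
promise on what it computes) has a `B_N`-circuit, `N = (|C|+|ι|+2)^a`, of size `≤ N`, computing SOME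
monotone function sandwiched between the envelopes `C↓ ≤ g ≤ C↑` of the function `C` computes. -/
def MSCB : Prop :=
  ∃ a : ℕ, ∀ (ι : Type) (_ : Fintype ι) (C : Circuit ι), C.IsOver B2 →
    ∃ (C' : Circuit ι) (g : (ι → Bool) → Bool),
      C'.IsOver (extGate ((C.size + Fintype.card ι + 2) ^ a)) ∧
        C'.size ≤ (C.size + Fintype.card ι + 2) ^ a ∧ C'.Computes g ∧ IsSandwich C.eval g

/-- **First lemma of the card (composition): `MSCB → Capture`.** On a circuit computing a monotone `f`
the sandwich collapses (`eq_of_isSandwich`), so the `B_N`-circuit of `MSCB` computes `f`. -/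
theorem capture_of_MSCB : MSCB → Capture := by
  rintro ⟨a, h⟩
  rw [capture_iff]
  refine ⟨a, fun ι _ f hf C hB hC => ?_⟩
  obtain ⟨C', g, h1, h2, h3, h4⟩ := h ι _ C hB
  have hfe : C.eval = f := funext hC
  rw [hfe] at h4
  have hg : g = f := eq_of_isSandwich hf h4
  refine ⟨C', h1, h2, fun x => ?_⟩
  rw [h3 x, hg]

/-- **MSC — the purely Boolean sandwich statement (no wide gates).** Every `B₂`-circuit has a
polynomial `B₂`-circuit computing some monotone function between its envelopes. `C↑` is in general
`NP`-hard and `C↓` `coNP`-hard (Jukna 2021 §3: CLIQUE is the upward closure of a trivial function), so the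
content is that SOME monotone function in between is easy. Status: open (this seat could neither prove
nor refute it; DNF/CNF, `Σ₂∘⊕`, `Π₂∘⊕₂`, AND/OR-of-thresholds cases hold — see the card). -/
def MSC : Prop :=
  ∃ a : ℕ, ∀ (ι : Type) (_ : Fintype ι) (C : Circuit ι), C.IsOver B2 →
    ∃ (C' : Circuit ι) (g : (ι → Bool) → Bool),
      C'.IsOver B2 ∧ C'.size ≤ (C.size + Fintype.card ι + 2) ^ a ∧ C'.Computes g ∧ IsSandwich C.eval g

/-- Under `MSC` the crux is EQUIVALENT to its promise-free strengthening: `MSC → Capture → MSCB`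
(apply `Capture` to the monotone `g` and the `B₂`-circuit `C'` supplied by `MSC`; exponents compose).
Statement only (exponent bookkeeping). -/
def MSCB_of_MSC_and_Capture : Prop := MSC → Capture → MSCB

/-! ### The complete instance: description-slice padding -/

section slicePad

variable {δ : Type*} [Fintype δ]

/-- Number of `true` coordinates of `z` on the two description blocks. -/
def descWeight (z : δ ⊕ δ ⊕ ι → Bool) : ℕ :=
  (Finset.univ.filter fun i : δ => z (Sum.inl i) = true).card +
    (Finset.univ.filter fun i : δ => z (Sum.inr (Sum.inl i)) = true).card

/-- **Description-slice padding** of a two-argument function `U d x` (think: `U` = a universal evaluator,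
`d` = the description of a circuit, `x` = its input): on inputs `(d, e, x)`, output `1` above the middle
description slice `|d|+|e| = |δ|`, `0` below it, and `[e = ¬d] ∧ U d x` on it. `V := slicePad U` is ONE
explicit (non-monotone, polynomial-size if `U` is) function. -/
def slicePad (U : (δ → Bool) → (ι → Bool) → Bool) : (δ ⊕ δ ⊕ ι → Bool) → Bool := fun z =>
  if Fintype.card δ < descWeight z then true
  else if descWeight z < Fintype.card δ then false
  else decide ((∀ i : δ, z (Sum.inr (Sum.inl i)) = !(z (Sum.inl i))) ∧
    U (fun i => z (Sum.inl i)) (fun j => z (Sum.inr (Sum.inr j))) = true)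

/-- The input `(d, ¬d, x)` of the padded function. -/
def padIn (d : δ → Bool) (x : ι → Bool) : δ ⊕ δ ⊕ ι → Bool :=
  fun w => match w with
    | Sum.inl i => d i
    | Sum.inr (Sum.inl i) => !(d i)
    | Sum.inr (Sum.inr j) => x j

/-- **Complete-instance lemma (statement).** A monotone sandwich `G` of the padded evaluator
`slicePad U` restricts, at every description `d`, to a monotone sandwich of the described function `U d`:
points comparable to `(d, ¬d, x)` off the middle slice are constants, and ON the slice the only point
comparable to `(d, ¬d, x)` with first blocks `(d', e')`, `e' = ¬d'`, is `d' = d`. Consequently `MSCB` (resp.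
`MSC`) for the single family `slicePad Uₜ`, `Uₜ` a universal circuit evaluator, implies `MSCB` (resp.
`MSC`) for all circuits of size `t` — and hence `Capture` — by plugging constants (arity-`0` CONV gates). -/
def CompleteInstance : Prop :=
  ∀ (δ ι : Type) (_ : Fintype δ) (_ : Fintype ι) (U : (δ → Bool) → (ι → Bool) → Bool)
    (G : (δ ⊕ δ ⊕ ι → Bool) → Bool), IsSandwich (slicePad U) G →
      ∀ d : δ → Bool, IsSandwich (U d) fun x => G (padIn d x)

end slicePad

/-! ## §2 Down-face rank repair (the CONV layer): rank `0` over the transcript LP -/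

/-- **Rank-0 criterion.** For a De Morgan circuit `C` computing a monotone `f`: no `0`-point `v` of `f`
admits a REAL point `x' ∈ [0,1]^ι` below `v` with an accepting (fractional) Valiant–Yannakakis LP
transcript (`CircuitLPFeasible`, tree `CircuitLP.lean`). Equivalently: every integer-empty downward cube
face of the transcript polytope is already EMPTY (Sherali–Adams / Lovász–Schrijver rank `0`). Sufficient
(Kleene evaluation dominates the LP): `C` has no `0`-hazard on ternary inputs whose unstable bits sit at
`1`-positions of a `0`-point. -/
def LPDownExact [Fintype ι] (C : Circuit ι) (f : (ι → Bool) → Bool) : Prop :=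
  ∀ v : ι → Bool, f v = false →
    ¬ ∃ (x : ι → ℝ) (w : Fin C.gates.length → ℝ),
      (∀ i, 0 ≤ x i ∧ x i ≤ realOfBool (v i)) ∧ CircuitLPFeasible C x w

/-- **Rank-zero repair (statement).** If the transcript LP of SOME De Morgan circuit `C` for the monotone
`f` is down-exact, then `f` is ONE CONV gate (LP case, `q = 0`) with `≤ 5·|C| + |ι| + 2` rows: the gate
`v ↦ [∃ (x', w) : 0 ≤ x' ≤ v, CircuitLPFeasible C x' w]` has `B = I ≥ 0`, accepts every `1`-point
(`x' := v`, `circuitLPFeasible_iff`) and, by `LPDownExact`, rejects every `0`-point. The rank-`r` version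
replaces the LP by `r` rounds of lift-and-project (`RankRepair`). -/
def RankZeroRepair : Prop :=
  ∀ (ι : Type) (_ : Fintype ι) (C : Circuit ι) (f : (ι → Bool) → Bool),
    C.IsOver deMorganBasis → C.Computes f → Monotone f → LPDownExact C f →
      ∃ C' : Circuit ι, C'.IsOver {g | IsConvGate (5 * C.size + Fintype.card ι + 2) g} ∧
        C'.size = 1 ∧ C'.Computes f

/-- An abstract LIFT-AND-PROJECT round on subsets of the cube `[0,1]^ι` (Sherali–Adams, Lovász–Schrijver
`N`/`N₊`, Lasserre, seen through their projections): shrinks, keeps the `0/1` points, commutes with the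
faces `{x_i = 0}` of the cube (Lovász–Schrijver 1991, Lemma 1.3-type face commutation), and reaches the
integer hull after `|ι|` rounds. The size field is bookkeeping for "one round costs a factor `poly(n)` in
the psd/LP description", not formalised here. -/
structure LiftOp (ι : Type*) [Fintype ι] where
  N : Set (ι → ℝ) → Set (ι → ℝ)
  shrink : ∀ K, N K ⊆ K
  keeps01 : ∀ K (x : ι → Bool), realPt x ∈ K → realPt x ∈ N K
  face : ∀ K (i : ι), N (K ∩ {y | y i = 0}) = N K ∩ {y | y i = 0}

/-- **Down-face rank repair (statement of the principle).** Let `K ⊆ [0,1]^ι` be ANY convex set whose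
`0/1` points are exactly `f⁻¹(1)` (`f` monotone; e.g. the projection of a non-monotone LP/SDP description,
or of the transcript polytope of a circuit for `f`). If `r` rounds empty every downward face
`K_v = K ∩ {y_i = 0, i ∉ v}` at `0`-points `v` (it suffices: at maxterms), then the UP-CLOSURE of `N^r K`
meets the cube exactly in `f⁻¹(1)` — i.e. `v ↦ [∃ y ∈ N^r K, y ≤ v]`, a CONV gate as typed (`B = I ≥ 0`)
whenever `N^r K` has a polynomial psd lift, computes `f`. Proof: `1`-points survive (`keeps01`); at a
`0`-point, `y ≤ v` with `y ∈ N^r K ⊆ [0,1]^ι` forces `y ∈ N^r K ∩ ⋂_{i ∉ v} {y_i = 0} = N^r (K_v) = ∅`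
(`face`, iterated). -/
def RankRepair : Prop :=
  ∀ (ι : Type) (_ : Fintype ι) (L : LiftOp ι) (f : (ι → Bool) → Bool) (K : Set (ι → ℝ)) (r : ℕ),
    Monotone f → (∀ y ∈ K, ∀ i, 0 ≤ y i ∧ y i ≤ 1) → (∀ x : ι → Bool, realPt x ∈ K ↔ f x = true) →
      (∀ v : ι → Bool, f v = false → L.N^[r] (K ∩ {y | ∀ i, v i = false → y i = 0}) = ∅) →
        ∀ v : ι → Bool, f v = true ↔ ∃ y ∈ L.N^[r] K, ∀ i, y i ≤ realOfBool (v i)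

end Summit.PneNP.PneNP.Cruxes.Capture.Ideator6
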